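import Summits.Ventures.DiscreteObjects.Hadamard.NormalizerPrimeMain
import Summits.Ventures.DiscreteObjects.Hadamard.PrimeOrderFixedRows668

/-!
# H(668): no block-preserving automorphism normalising an element of order 13 acts on it through the squares (kernel EXCLUSION of
# the matrix-level classes `C₁₃ ⋊ C₆`, `C₁₃ ⋊ C₁₂`)

Framing: lottery ticket; floor = certified bounds/negative ranges.

Cell pub-namedobj (venture DiscreteObjects), target (H), hadamard gen 20; the order-13 instance of `NormalizerPrimeMain`.  Let
`σ = (π, κ, d, e)` be a signed automorphism of a Hadamard matrix of order `668` with `π^13 = κ^13 = 1`, `(π, κ) ≠ (1,1)` (census gen 6,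
`hadamard668_fixedRows_13`: `44` fixed rows and columns, `48 + 48` orbits) and `τ = (π', κ', d', e')` a signed automorphism with
`π'π = π^μ π'`, `κ'κ = κ^μ κ'` keeping a free row `x₀` and every free column inside its `σ`-orbit.  Then
(**`hadamard668_order13_normalizer_not_square_generator`**) **no power of `μ` is `≡ 4 (mod 13)`** (`4` generates the squares
`C₆ ≤ (ℤ/13)ˣ`; so `ord(μ mod 13) ∉ {6, 12}`).  [`normalizing_prime_main`: `48` `±1` sequences with `Σ PAF(s) = −44` for `s ≠ 0`,
twisted `μ`-invariant; recentre; `4`-invariance makes each a three-valued block (`eq_blk13`, tables checked by `decide`) with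
`PAF(1) + PAF(2) ∈ {−2, 18, 26}` (`2` a non-square; `decide`); with `t_y = PAF_y(1) + PAF_y(2) + 2 ∈ {0, 20, 28}`,
`Σ t_y = −88 + 96 = 8` is impossible.]  BLOCK-PRESERVING ONLY.  EXCLUSION of a symmetry type of a hypothetical object; no order
excluded; H(668) untouched; HITS 0/4.  Ours; no `sorry`; definitions = the three kernel-checked tables and the block (gen-4 style).
-/

namespace Summit.Ventures.DiscreteObjects.Hadamard

open Finset BigOperators Matrix

open Literature.Combinatorics.Designs.GoethalsSeidel (IsHadamardMatrix)
open Literature.Combinatorics.Designs.LegendrePairs (PAF IsPM TwistedInvariant HInvariant PAF_translate)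

variable {ι : Type*} [Fintype ι] [DecidableEq ι]

/-! ### the orbit of the multiplier `2` on `ZMod 13` (tables, kernel-checked) -/

/-- walk along the orbit of `1` under the multiplier `4`: `orb13 k = 4^k` in `ZMod 13` (`4` is a square mod `13` and has order `6`: it
generates the non-zero squares) -/
def orb13 : ℕ → ZMod 13
  | 0 => 1
  | k + 1 => 4 * orb13 k

/-- discrete-logarithm table for `ZMod 13`: for `i ≠ 0`, `orb13 (dlog13[i]) = i` if `i` is a square and `2 · orb13 (dlog13[i]) = i`
otherwise (`2` is a non-square mod 13) -/
def dlog13 : List ℕ := [0, 0, 0, 2, 1, 4, 2, 5, 1, 4, 5, 3, 3]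

/-- bit mask of the 6 non-zero squares modulo 13 -/
def qrMask13 : ℕ := 5658

/-- `i` is a non-zero quadratic residue mod 13 (table lookup) -/
def isQR13 (i : ZMod 13) : Bool := Nat.testBit qrMask13 i.val

set_option maxRecDepth 100000 in
set_option maxHeartbeats 4000000 in
/-- kernel check of both tables: every residue is `0`, a square `orb13 (dlog13[i])`, or a non-square `2 · orb13 (dlog13[i])` -/
theorem orbit_cover13 : ∀ i : ZMod 13,
    i = 0 ∨ (isQR13 i = true ∧ orb13 (dlog13.getD i.val 0) = i) ∨ (isQR13 i = false ∧ 2 * orb13 (dlog13.getD i.val 0) = i) := by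
  decide

/-- invariance under `i ↦ 4 i` propagates along the orbit walk, from `1` and from `2` -/
lemma apply_orb13 {α : Type*} (x : ZMod 13 → α) (hinv : ∀ i, x (4 * i) = x i) (k : ℕ) :
    x (orb13 k) = x 1 ∧ x (2 * orb13 k) = x 2 := by
  induction k with
  | zero => simp [orb13]
  | succ k ih =>
    refine ⟨?_, ?_⟩
    · show x (4 * orb13 k) = x 1
      rw [hinv]; exact ih.1
    · show x (2 * (4 * orb13 k)) = x 2
      rw [mul_left_comm, hinv]; exact ih.2

/-- the three-valued block on `ZMod 13`: `e0` at `0`, `e1` on the non-zero squares, `e2` on the non-squares -/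
def blk13 {α : Type*} (e0 e1 e2 : α) (i : ZMod 13) : α :=
  if i = 0 then e0 else if isQR13 i = true then e1 else e2

/-- a `4`-invariant function on `ZMod 13` is the block of its values at `0`, `1` and `2` -/
theorem eq_blk13 {α : Type*} (x : ZMod 13 → α) (hinv : ∀ i, x (4 * i) = x i) :
    x = blk13 (x 0) (x 1) (x 2) := by
  funext i
  by_cases hi : i = 0
  · subst hi; simp [blk13]
  · rcases orbit_cover13 i with h0 | ⟨hq, he⟩ | ⟨hq, he⟩
    · exact absurd h0 hi
    · have h := (apply_orb13 x hinv (dlog13.getD i.val 0)).1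
      rw [he] at h
      unfold blk13; rw [if_neg hi, if_pos hq]; exact h
    · have h := (apply_orb13 x hinv (dlog13.getD i.val 0)).2
      rw [he] at h
      have hq' : ¬ (isQR13 i = true) := by rw [hq]; exact Bool.false_ne_true
      unfold blk13; rw [if_neg hi, if_neg hq']; exact h

set_option maxRecDepth 100000 in
set_option maxHeartbeats 4000000 in
/-- the eight `±1` three-valued blocks on `ZMod 13` have `PAF(1) + PAF(2) ∈ {−2, 18, 26}` (kernel evaluation; `2` a non-square) -/
theorem paf_blk13_pm : ∀ e0 ∈ [(1 : ℤ), -1], ∀ e1 ∈ [(1 : ℤ), -1], ∀ e2 ∈ [(1 : ℤ), -1],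
    PAF (blk13 e0 e1 e2) 1 + PAF (blk13 e0 e1 e2) 2 = -2 ∨ PAF (blk13 e0 e1 e2) 1 + PAF (blk13 e0 e1 e2) 2 = 18 ∨
      PAF (blk13 e0 e1 e2) 1 + PAF (blk13 e0 e1 e2) 2 = 26 := by
  decide

/-- `PAF(1) + PAF(2)` of a `4`-invariant `±1` sequence on `ZMod 13` is `−2`, `18` or `26` -/
theorem paf_of_inv4_13 (x : ZMod 13 → ℤ) (hx : IsPM x) (hinv : ∀ i, x (4 * i) = x i) :
    PAF x 1 + PAF x 2 = -2 ∨ PAF x 1 + PAF x 2 = 18 ∨ PAF x 1 + PAF x 2 = 26 := by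
  have mem : ∀ {e : ℤ}, (e = 1 ∨ e = -1) → e ∈ [(1 : ℤ), -1] := fun h => by rcases h with rfl | rfl <;> simp
  rw [eq_blk13 x hinv]
  exact paf_blk13_pm (x 0) (mem (hx 0)) (x 1) (mem (hx 1)) (x 2) (mem (hx 2))

omit [Fintype ι] [DecidableEq ι] in
/-- square-invariant `±1` sequences on `ZMod 13` never have `Σ (PAF(1) + PAF(2) + 2) = 8` (each term is `0` or `≥ 20`) -/
lemma sum_family_qr13 {T : Finset ι} (x : ι → ZMod 13 → ℤ) (hpm : ∀ y ∈ T, IsPM (x y))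
    (h4 : ∀ y ∈ T, ∀ i, x y (4 * i) = x y i) : ∑ y ∈ T, (PAF (x y) 1 + PAF (x y) 2 + 2) ≠ 8 := by
  have hval : ∀ y ∈ T, PAF (x y) 1 + PAF (x y) 2 + 2 = 0 ∨ 20 ≤ PAF (x y) 1 + PAF (x y) 2 + 2 := by
    intro y hy
    rcases paf_of_inv4_13 (x y) (hpm y hy) (h4 y hy) with h | h | h <;> rw [h] <;> norm_num
  have hnn : ∀ y ∈ T, 0 ≤ PAF (x y) 1 + PAF (x y) 2 + 2 := fun y hy => by rcases hval y hy with h | h <;> omega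
  by_cases hex : ∃ y ∈ T, PAF (x y) 1 + PAF (x y) 2 + 2 ≠ 0
  · obtain ⟨y₁, hy₁, hne₁⟩ := hex
    have h20 : 20 ≤ PAF (x y₁) 1 + PAF (x y₁) 2 + 2 := by
      rcases hval y₁ hy₁ with h | h
      · exact absurd h hne₁
      · exact h
    have := Finset.single_le_sum hnn hy₁
    omega
  · push Not at hex
    rw [Finset.sum_eq_zero hex]
    norm_num

section main
variable {H : Matrix ι ι ℤ}

/-- **EXCLUSION (order 13, block-preserving normalisers do not act through the squares).**  `σ = (π, κ, d, e)` a signed automorphism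
of an H(668) with `π^13 = κ^13 = 1`, `(π, κ) ≠ (1,1)`; `τ` a signed automorphism with `π'π = π^μ π'`, `κ'κ = κ^μ κ'` keeping the free
row `x₀` and every free column inside its `σ`-orbit; then **no power `μ^k` is `≡ 4 (mod 13)`** (`ord(μ mod 13) ∉ {6, 12}`). -/
theorem hadamard668_order13_normalizer_not_square_generator (hH : IsHadamardMatrix H) (hι : Fintype.card ι = 668)
    {π κ π' κ' : Equiv.Perm ι} {d e d' e' : ι → ℤ} (haut : IsSignedAut H π κ d e)
    (hπ : π ^ 13 = 1) (hκ : κ ^ 13 = 1) (hne : π ≠ 1 ∨ κ ≠ 1)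
    (haut' : IsSignedAut H π' κ' d' e') {μ : ℕ} (hnπ : π' * π = π ^ μ * π') (hnκ : κ' * κ = κ ^ μ * κ')
    {x₀ : ι} (hx₀ : π x₀ ≠ x₀) (hrow : π' x₀ ∈ orbFin π 13 x₀) (hcols : ∀ y, κ y ≠ y → κ' y ∈ orbFin κ 13 y)
    (k : ℕ) : (μ : ZMod 13) ^ k ≠ 4 := by
  have h10 : (1 : ZMod 13) ≠ 0 := by decide
  have h20 : (2 : ZMod 13) ≠ 0 := by decide
  have h41 : (4 : ZMod 13) ≠ 1 := by decide
  intro hk4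
  have h13 := hadamard668_fixedRows_13 hH hι π κ d e haut hπ hκ hne
  obtain ⟨u, T, x, hu, hTc, hpm, hgs, htw⟩ := normalizing_prime_main (by norm_num : Nat.Prime 13) (by decide : Odd 13)
    hH haut hπ hκ hne haut' hnπ hnκ hx₀ hrow hcols
  have hsplit := Finset.card_filter_add_card_filter_not (s := (univ : Finset ι)) (fun y => κ y = y)
  rw [h13.2, Finset.card_univ, hι] at hsplit
  have hm : (univ.filter fun y => ¬ κ y = y).card = 624 := by omega
  have hm' : (univ.filter fun y => κ y ≠ y).card = 624 := hm
  rw [hm'] at hTc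
  have hT48 : T.card = 48 := by omega
  rw [h13.2] at hgs
  rw [← hu] at hk4
  have hu1 : (u : ZMod 13) ≠ 1 := fun h => h41 (by rw [← hk4, h, one_pow])
  haveI : Fact (Nat.Prime 13) := ⟨by norm_num⟩
  have hrec : ∀ y ∈ T, ∃ δ : ZMod 13, HInvariant (Literature.Combinatorics.Designs.LegendrePairs.translate (x y) δ) u :=
    fun y hy => exists_translate_hInvariant_prime (x y) u hu1 (htw y hy)
  choose! δ hδ using hrec
  set x' : ι → ZMod 13 → ℤ := fun y => Literature.Combinatorics.Designs.LegendrePairs.translate (x y) (δ y) with hx'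
  have hpm' : ∀ y ∈ T, IsPM (x' y) := fun y hy r => hpm y hy _
  have h4' : ∀ y ∈ T, ∀ i, x' y (4 * i) = x' y i := by
    intro y hy
    have hpow : ∀ n : ℕ, ∀ i, x' y ((u : ZMod 13) ^ n * i) = x' y i := by
      intro n; induction n with
      | zero => intro i; simp
      | succ n ih => intro i; rw [pow_succ, mul_assoc, ih]; exact hδ y hy i
    intro i; rw [← hk4]; exact hpow k i
  have hgs1 : ∑ y ∈ T, PAF (x' y) 1 = -44 := by
    rw [Finset.sum_congr rfl fun y _ => PAF_translate (x y) (δ y) 1]; simpa using hgs 1 h10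
  have hgs2 : ∑ y ∈ T, PAF (x' y) 2 = -44 := by
    rw [Finset.sum_congr rfl fun y _ => PAF_translate (x y) (δ y) 2]; simpa using hgs 2 h20
  refine sum_family_qr13 x' hpm' h4' ?_
  rw [Finset.sum_add_distrib, Finset.sum_add_distrib, hgs1, hgs2, Finset.sum_const, hT48]
  norm_num

end main

end Summit.Ventures.DiscreteObjects.Hadamard
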